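import Mathlib.Analysis.Complex.CauchyIntegral
import Mathlib.Analysis.Analytic.IsolatedZeros
import Mathlib.Analysis.Complex.ReImTopology
import Mathlib.Analysis.Complex.Convex
import Mathlib.Analysis.InnerProductSpace.Dual
import HarnessLib

/-!
# Tools for holomorphic families of sesquilinear forms on the right half-plane

Three generic tools used to build the holomorphic semigroup `e^{-τH}` of Osterwalder–Schrader
reconstruction (OS I (1973), §4.1 p. 92) from its diagonal matrix elements
(`Literature.MathematicalPhysics.QuantumFieldTheory.OSDistributionSpaceHolomorphic`):

* `eqOn_closedHalfPlane_of_eqOn_ofReal` — **identity theorem from the positive real axis**: two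
  functions holomorphic on the open right half-plane `{Re z > 0}`, continuous on the closed one and
  equal at all real `s > 0` agree on `{Re z ≥ 0}` (one-variable identity theorem on the convex open
  half-plane, then `Set.EqOn.of_subset_closure`);
* `polarization Q x y` — the **polarization** `¼ (Q(x+y) − Q(x−y) − i Q(x+iy) + i Q(x−iy))` of a
  function `Q : H → ℂ` on a complex inner product space, with `inner_apply_eq_polarization`:
  `⟪x, T y⟫ = polarization (χ ↦ ⟪χ, Tχ⟫) x y` for every bounded operator `T`, and the bound
  `‖polarization Q x y‖ ≤ C (‖x‖² + ‖y‖²)` when `‖Q χ‖ ≤ C ‖χ‖²` (`norm_polarization_le`,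
  parallelogram law);
* `IsSesqForm S` and `IsSesqForm.operator` — the bounded operator `T` with `⟪x, T y⟫ = S x y`
  attached to a sesquilinear `S : H → H → ℂ` (conjugate-linear in `x`, linear in `y`) with
  `‖S x y‖ ≤ C ‖x‖ ‖y‖` (Riesz representation, Mathlib's
  `InnerProductSpace.continuousLinearMapOfBilin`), with `IsSesqForm.inner_operator`,
  `IsSesqForm.operator_unique` and the norm bound `IsSesqForm.opNorm_operator_le` (`‖T‖ ≤ C`); and
  `IsSesqForm.norm_le_of_norm_le_sq_add_sq`, upgrading a bound `C (‖x‖² + ‖y‖²)` for a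
  sesquilinear `S` to `2C ‖x‖ ‖y‖` (scaling).

(The name `polarization` avoids Mathlib's `QuadraticMap.polar` / `NormedSpace.polar`, which mean
something else.)

## References
* K. Osterwalder, R. Schrader, Axioms for Euclidean Green's functions, CMP 31 (1973), §4.1 p. 92.
* M. Reed, B. Simon, Methods of Modern Mathematical Physics I (rev. ed. 1980), §VII.2
  (polarization and the Riesz lemma in the construction of `g(A)`).
-/

noncomputable section

open Set Filter
open _root_.Topology _root_.Complex
open scoped InnerProductSpace ComplexConjugate

namespace Literature.Analysis.OperatorTheory

/-! ## The identity theorem from the positive real axis -/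

/-- **Identity theorem from the positive real axis.** If `f, g : ℂ → ℂ` (values in a complex
Banach space would do; `ℂ` suffices here) are holomorphic on `{Re z > 0}`, continuous on
`{Re z ≥ 0}`, and `f s = g s` for all real `s > 0`, then `f = g` on `{Re z ≥ 0}`. [folklore] -/
theorem eqOn_closedHalfPlane_of_eqOn_ofReal {f g : ℂ → ℂ}
    (hf : DifferentiableOn ℂ f {z : ℂ | 0 < z.re}) (hg : DifferentiableOn ℂ g {z : ℂ | 0 < z.re})
    (hfc : ContinuousOn f {z : ℂ | 0 ≤ z.re}) (hgc : ContinuousOn g {z : ℂ | 0 ≤ z.re})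
    (h : ∀ s : ℝ, 0 < s → f s = g s) : EqOn f g {z : ℂ | 0 ≤ z.re} := by
  have hU : IsOpen {z : ℂ | 0 < z.re} := isOpen_lt continuous_const Complex.continuous_re
  -- Step 1: on the open half-plane, by the identity theorem at the point `1`
  have hopen : EqOn f g {z : ℂ | 0 < z.re} := by
    have hfa : AnalyticOnNhd ℂ f {z : ℂ | 0 < z.re} := hf.analyticOnNhd hU
    have hga : AnalyticOnNhd ℂ g {z : ℂ | 0 < z.re} := hg.analyticOnNhd hU
    have hpc : IsPreconnected {z : ℂ | 0 < z.re} := (convex_halfSpace_re_gt (r := 0)).isPreconnected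
    have h1 : (1 : ℂ) ∈ {z : ℂ | 0 < z.re} := by simp
    refine hfa.eqOn_of_preconnected_of_frequently_eq hga hpc h1 ?_
    -- `f = g` frequently near `1` (at the real points)
    have hreal : ∀ᶠ t : ℝ in 𝓝 1, f t = g t := by
      filter_upwards [Ioi_mem_nhds (zero_lt_one' ℝ)] with t ht using h t ht
    have htend : Tendsto (fun t : ℝ => (t : ℂ)) (𝓝[≠] 1) (𝓝[≠] 1) := by
      refine (Complex.continuous_ofReal.continuousWithinAt).tendsto_nhdsWithin ?_
      intro t ht
      simpa using ht
    simpa using htend.frequently (eventually_nhdsWithin_of_eventually_nhds hreal).frequently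
  -- Step 2: pass to the closure by continuity
  refine hopen.of_subset_closure hfc hgc (fun z hz => (le_of_lt hz : (0 : ℝ) ≤ z.re)) ?_
  rw [closure_setOf_lt_re]

/-! ## Polarization -/

section Polar

variable {H : Type*} [NormedAddCommGroup H] [InnerProductSpace ℂ H]

/-- The **polarization** of a function `Q : H → ℂ` (thought of as the diagonal `χ ↦ S(χ, χ)` of a
sesquilinear form conjugate-linear in the first variable):
`polarization Q x y = ¼ (Q(x+y) − Q(x−y) − i Q(x+iy) + i Q(x−iy))`. [folklore] -/
def polarization (Q : H → ℂ) (x y : H) : ℂ :=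
  (Q (x + y) - Q (x - y) - I * Q (x + I • y) + I * Q (x - I • y)) / 4

/-- **Polarization identity** for matrix elements of a bounded operator:
`⟪x, T y⟫ = polarization (χ ↦ ⟪χ, T χ⟫) x y`. [folklore] -/
theorem inner_apply_eq_polarization (T : H →L[ℂ] H) (x y : H) :
    ⟪x, T y⟫_ℂ = polarization (fun χ => ⟪χ, T χ⟫_ℂ) x y := by
  simp only [polarization, map_add, map_sub, map_smul, inner_add_left, inner_add_right, inner_sub_left,
    inner_sub_right, inner_smul_left, inner_smul_right, Complex.conj_I]
  ring_nf
  rw [Complex.I_sq]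
  ring

/-- `polarization` is linear in `Q` in the obvious sense: constants. [folklore] -/
theorem polarization_const_mul (c : ℂ) (Q : H → ℂ) (x y : H) :
    polarization (fun χ => c * Q χ) x y = c * polarization Q x y := by
  simp only [polarization]; ring

/-- **Bound for the polarization** from a quadratic bound on the diagonal:
`‖Q χ‖ ≤ C ‖χ‖²` for all `χ` implies `‖polarization Q x y‖ ≤ C (‖x‖² + ‖y‖²)` (parallelogram law). [folklore] -/
theorem norm_polarization_le {Q : H → ℂ} {C : ℝ} (hQ : ∀ χ, ‖Q χ‖ ≤ C * ‖χ‖ ^ 2) (x y : H) :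
    ‖polarization Q x y‖ ≤ C * (‖x‖ ^ 2 + ‖y‖ ^ 2) := by
  have hI : ‖(I : ℂ)‖ = 1 := Complex.norm_I
  have h1 := hQ (x + y)
  have h2 := hQ (x - y)
  have h3 := hQ (x + I • y)
  have h4 := hQ (x - I • y)
  have e1 : ‖x + y‖ ^ 2 + ‖x - y‖ ^ 2 = 2 * (‖x‖ ^ 2 + ‖y‖ ^ 2) :=
    parallelogram_law_with_norm ℂ x y
  have e2 : ‖x + I • y‖ ^ 2 + ‖x - I • y‖ ^ 2 = 2 * (‖x‖ ^ 2 + ‖y‖ ^ 2) := by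
    have := parallelogram_law_with_norm ℂ x (I • y)
    rwa [norm_smul, hI, one_mul] at this
  have hIC : ‖I * Q (x + I • y)‖ = ‖Q (x + I • y)‖ := by rw [norm_mul, hI, one_mul]
  have hID : ‖I * Q (x - I • y)‖ = ‖Q (x - I • y)‖ := by rw [norm_mul, hI, one_mul]
  have htri : ‖Q (x + y) - Q (x - y) - I * Q (x + I • y) + I * Q (x - I • y)‖ ≤
      ‖Q (x + y)‖ + ‖Q (x - y)‖ + ‖Q (x + I • y)‖ + ‖Q (x - I • y)‖ := by
    calc ‖Q (x + y) - Q (x - y) - I * Q (x + I • y) + I * Q (x - I • y)‖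
        ≤ ‖Q (x + y) - Q (x - y) - I * Q (x + I • y)‖ + ‖I * Q (x - I • y)‖ := norm_add_le _ _
      _ ≤ ‖Q (x + y) - Q (x - y)‖ + ‖I * Q (x + I • y)‖ + ‖I * Q (x - I • y)‖ := by
          gcongr; exact norm_sub_le _ _
      _ ≤ ‖Q (x + y)‖ + ‖Q (x - y)‖ + ‖I * Q (x + I • y)‖ + ‖I * Q (x - I • y)‖ := by
          gcongr; exact norm_sub_le _ _
      _ = _ := by rw [hIC, hID]
  calc ‖polarization Q x y‖
      = ‖Q (x + y) - Q (x - y) - I * Q (x + I • y) + I * Q (x - I • y)‖ / 4 := by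
        rw [polarization, norm_div]; norm_num
    _ ≤ (‖Q (x + y)‖ + ‖Q (x - y)‖ + ‖Q (x + I • y)‖ + ‖Q (x - I • y)‖) / 4 := by gcongr
    _ ≤ (C * ‖x + y‖ ^ 2 + C * ‖x - y‖ ^ 2 + C * ‖x + I • y‖ ^ 2 + C * ‖x - I • y‖ ^ 2) / 4 := by
        gcongr
    _ = C * (‖x‖ ^ 2 + ‖y‖ ^ 2) := by
        linear_combination (C / 4) * e1 + (C / 4) * e2

end Polar

/-! ## Bounded sesquilinear functions and their operators -/

section Operator

variable {H : Type*} [NormedAddCommGroup H] [InnerProductSpace ℂ H]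

/-- A function `S : H → H → ℂ` is **sesquilinear** (conjugate-linear in the first variable,
linear in the second — the convention of `⟪·, ·⟫`). [folklore] -/
structure IsSesqForm (S : H → H → ℂ) : Prop where
  /-- additivity in the first variable -/
  add_left : ∀ x x' y, S (x + x') y = S x y + S x' y
  /-- conjugate-homogeneity in the first variable -/
  smul_left : ∀ (c : ℂ) x y, S (c • x) y = conj c * S x y
  /-- additivity in the second variable -/
  add_right : ∀ x y y', S x (y + y') = S x y + S x y'
  /-- homogeneity in the second variable -/
  smul_right : ∀ (c : ℂ) x y, S x (c • y) = c * S x y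

/-- The matrix-element function `(x, y) ↦ ⟪x, T y⟫` of a bounded operator is sesquilinear. [folklore] -/
theorem isSesqForm_inner_apply (T : H →L[ℂ] H) : IsSesqForm fun x y => ⟪x, T y⟫_ℂ where
  add_left x x' y := inner_add_left _ _ _
  smul_left c x y := inner_smul_left _ _ _
  add_right x y y' := by rw [map_add, inner_add_right]
  smul_right c x y := by rw [map_smul, inner_smul_right]

namespace IsSesqForm

variable {S : H → H → ℂ}

/-- `S 0 y = 0`. [folklore] -/
theorem zero_left (hS : IsSesqForm S) (y : H) : S 0 y = 0 := by
  have := hS.smul_left 0 0 y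
  simpa using this

/-- `S x 0 = 0`. [folklore] -/
theorem zero_right (hS : IsSesqForm S) (x : H) : S x 0 = 0 := by
  have := hS.smul_right 0 x 0
  simpa using this

/-- **Scaling upgrade of a quadratic bound**: a sesquilinear `S` with
`‖S x y‖ ≤ C (‖x‖² + ‖y‖²)` satisfies `‖S x y‖ ≤ 2C ‖x‖ ‖y‖` (apply the bound to the unit
vectors `x/‖x‖`, `y/‖y‖` and rescale by sesquilinearity). [folklore] -/
theorem norm_le_of_norm_le_sq_add_sq (hS : IsSesqForm S) {C : ℝ}
    (h : ∀ x y, ‖S x y‖ ≤ C * (‖x‖ ^ 2 + ‖y‖ ^ 2)) (x y : H) :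
    ‖S x y‖ ≤ 2 * C * ‖x‖ * ‖y‖ := by
  by_cases hx : x = 0
  · subst hx; rw [hS.zero_left]; simp
  by_cases hy : y = 0
  · subst hy; rw [hS.zero_right]; simp
  have hxp : 0 < ‖x‖ := norm_pos_iff.2 hx
  have hyp : 0 < ‖y‖ := norm_pos_iff.2 hy
  -- rescale to unit vectors
  set u : H := (‖x‖⁻¹ : ℂ) • x with hu
  set v : H := (‖y‖⁻¹ : ℂ) • y with hv
  have hnu : ‖u‖ = 1 := by
    rw [hu, norm_smul, norm_inv, Complex.norm_real, Real.norm_eq_abs, abs_of_pos hxp,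
      inv_mul_cancel₀ hxp.ne']
  have hnv : ‖v‖ = 1 := by
    rw [hv, norm_smul, norm_inv, Complex.norm_real, Real.norm_eq_abs, abs_of_pos hyp,
      inv_mul_cancel₀ hyp.ne']
  have huv : ‖S u v‖ ≤ 2 * C := by
    have := h u v
    rw [hnu, hnv] at this
    linarith
  have hxu : x = (‖x‖ : ℂ) • u := by
    rw [hu, smul_smul, mul_inv_cancel₀ (by exact_mod_cast hxp.ne'), one_smul]
  have hyv : y = (‖y‖ : ℂ) • v := by
    rw [hv, smul_smul, mul_inv_cancel₀ (by exact_mod_cast hyp.ne'), one_smul]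
  have key : S x y = conj ((‖x‖ : ℂ)) * ((‖y‖ : ℂ) * S u v) := by
    have h' : S ((‖x‖ : ℂ) • u) ((‖y‖ : ℂ) • v) = conj ((‖x‖ : ℂ)) * ((‖y‖ : ℂ) * S u v) := by
      rw [hS.smul_left, hS.smul_right]
    rwa [← hxu, ← hyv] at h'
  rw [key, norm_mul, norm_mul, Complex.norm_conj, Complex.norm_real, Complex.norm_real,
    Real.norm_eq_abs, Real.norm_eq_abs, abs_of_pos hxp, abs_of_pos hyp]
  calc ‖x‖ * (‖y‖ * ‖S u v‖) ≤ ‖x‖ * (‖y‖ * (2 * C)) := by gcongr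
    _ = 2 * C * ‖x‖ * ‖y‖ := by ring

/-- The continuous sesquilinear map `H →L⋆[ℂ] H →L[ℂ] ℂ`, `v ↦ (w ↦ conj (S w v))`, attached to
a bounded sesquilinear `S` — the input format of Mathlib's Riesz construction
`InnerProductSpace.continuousLinearMapOfBilin` (which produces `T` with `⟪T v, w⟫ = B v w`; we want
`⟪x, T y⟫ = S x y`, i.e. `B v w = conj (S w v)`). [folklore] -/
def toBilin (hS : IsSesqForm S) {C : ℝ} (h : ∀ x y, ‖S x y‖ ≤ C * ‖x‖ * ‖y‖) :
    H →L⋆[ℂ] H →L[ℂ] ℂ :=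
  LinearMap.mkContinuous₂
    (LinearMap.mk₂'ₛₗ (starRingEnd ℂ) (RingHom.id ℂ) (fun v w => conj (S w v))
      (fun v v' w => by rw [hS.add_right, map_add])
      (fun c v w => by rw [hS.smul_right, map_mul, smul_eq_mul])
      (fun v w w' => by rw [hS.add_left, map_add])
      (fun c v w => by rw [hS.smul_left, map_mul, Complex.conj_conj, RingHom.id_apply, smul_eq_mul]))
    C (fun v w => by
      simp only [LinearMap.mk₂'ₛₗ_apply, Complex.norm_conj]
      calc ‖S w v‖ ≤ C * ‖w‖ * ‖v‖ := h w v
        _ = C * ‖v‖ * ‖w‖ := by ring)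

/-- Evaluation of `toBilin`. [folklore] -/
@[simp]
theorem toBilin_apply (hS : IsSesqForm S) {C : ℝ} (h : ∀ x y, ‖S x y‖ ≤ C * ‖x‖ * ‖y‖) (v w : H) :
    hS.toBilin h v w = conj (S w v) := rfl

variable [CompleteSpace H]

/-- **The operator of a bounded sesquilinear function** (Riesz representation): the unique
bounded `T` with `⟪x, T y⟫ = S x y`. [folklore] -/
def operator (hS : IsSesqForm S) {C : ℝ} (h : ∀ x y, ‖S x y‖ ≤ C * ‖x‖ * ‖y‖) : H →L[ℂ] H :=
  InnerProductSpace.continuousLinearMapOfBilin (hS.toBilin h)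

/-- **Defining property**: `⟪x, T y⟫ = S x y`. [folklore] -/
theorem inner_operator (hS : IsSesqForm S) {C : ℝ} (h : ∀ x y, ‖S x y‖ ≤ C * ‖x‖ * ‖y‖) (x y : H) :
    ⟪x, hS.operator h y⟫_ℂ = S x y := by
  rw [operator, ← inner_conj_symm, InnerProductSpace.continuousLinearMapOfBilin_apply, toBilin_apply,
    Complex.conj_conj]

/-- Uniqueness: an operator is determined by its matrix elements. [folklore] -/
theorem operator_unique (hS : IsSesqForm S) {C : ℝ} (h : ∀ x y, ‖S x y‖ ≤ C * ‖x‖ * ‖y‖)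
    {T : H →L[ℂ] H} (hT : ∀ x y, ⟪x, T y⟫_ℂ = S x y) : T = hS.operator h := by
  refine ContinuousLinearMap.ext fun y => ?_
  refine ext_inner_left ℂ fun x => ?_
  rw [hT, inner_operator]

/-- **Norm bound** `‖T‖ ≤ C` (for `C ≥ 0`): `‖T y‖² = ⟪T y, T y⟫ = S (T y) y ≤ C ‖T y‖ ‖y‖`. [folklore] -/
theorem opNorm_operator_le (hS : IsSesqForm S) {C : ℝ} (hC : 0 ≤ C) (h : ∀ x y, ‖S x y‖ ≤ C * ‖x‖ * ‖y‖) :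
    ‖hS.operator h‖ ≤ C := by
  refine ContinuousLinearMap.opNorm_le_bound _ hC fun y => ?_
  set T := hS.operator h
  by_cases hTy : T y = 0
  · rw [hTy, norm_zero]; positivity
  have hpos : 0 < ‖T y‖ := norm_pos_iff.2 hTy
  have h1 : ‖T y‖ ^ 2 ≤ C * ‖T y‖ * ‖y‖ := by
    have := h (T y) y
    rw [← inner_operator hS h (T y) y] at this
    rw [← inner_self_eq_norm_sq (𝕜 := ℂ)]
    exact (RCLike.re_le_norm _).trans this
  have h2 : ‖T y‖ * ‖T y‖ ≤ ‖T y‖ * (C * ‖y‖) := by nlinarith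
  exact le_of_mul_le_mul_left h2 hpos

end IsSesqForm

end Operator

end Literature.Analysis.OperatorTheory
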